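import Summits.Langlands.Langlands.Theses.RationalPeriodQuarter
import Summits.Langlands.Langlands.Theorems.RationalPeriodQuarterFormsAlg
import Summits.Langlands.Langlands.Theorems.RationalPeriodQuarterProjection

/-!
# `RationalFormsInjectivity` — child A of the split of `HeckeFieldOfCruxes` (stmt-Langlands-10432)

    PeriodClassNontrivialQuarter → SemiAnalyticRigidity →
      (ℚ-linearly independent rational-period quarter cusp forms on Γ₁(N) are ℂ-linearly independent)

(Assembly step (2) of route `RationalPeriodQuarter`, stmt-2813: injectivity of `ℂ ⊗_ℚ span_ℚ S_ℚ(N) → (ℍ → ℂ)`.)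
Proof.  Let `∑ g_j v_j = 0` over `ℂ` with `v` `ℚ`-independent.  Write `g_j = ∑_l e_l r_{lj}` with `e` `ℚ`-independent
and `r` rational (`rpq_coeff_decomp`) and put `w_l := ∑_j r_{lj} v_j` — quarter cusp forms with rational period classes
`(Q_l, F_l)` by linearity of the Lewis–Zagier period integral (`rpqLZ_linComb`) and of the inlined predicates
(`RationalPeriodQuarterFormsAlg`).  Since `∑_l e_l w_l = 0`, the period integral gives, for every `γ ∈ Γ₁(N)`,
`∑_l e_l Q_l(γ) = G − G|γ` cofinitely with `G := ∑_l e_l F_l` semi-analytic; `SemiAnalyticRigidity` (h₃) makes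
`G = ρ ∈ PR_ℂ` cofinitely, and the projection lemma `rpq_projection` (`PR_ℂ = PR_ℚ ⊗ ℂ` coefficientwise, dual
functionals `π_l` with `π_l(e_{l'}) = δ`) yields `Q_l(γ) = ρ_l − ρ_l|γ` with `ρ_l ∈ PR_ℂ`.  Hence the period class of
`w_l` is represented by the coboundary of the semi-analytic `F_l − ρ_l`, so `PeriodClassNontrivialQuarter` (h₂) forces
`w_l = 0`; `ℚ`-independence of `v` gives `r = 0`, hence `g = 0`.
-/

set_option linter.dupNamespace false

namespace Summit.Langlands.Langlands.Theorems

open scoped BigOperators Topology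
open Filter Set Polynomial

open Summit.Langlands.Langlands.Theses.RationalPeriodQuarter in
/-- Child A `RationalFormsInjectivity` of the node `HeckeFieldOfCruxesSplit` (interface inlined verbatim):
`ℚ`-linearly independent rational-period quarter cusp forms on `Γ₁(N)` are `ℂ`-linearly independent. -/
theorem rationalFormsInjectivity_statement :
    PeriodClassNontrivialQuarter → SemiAnalyticRigidity → (let slashHalf : Matrix.SpecialLinearGroup (Fin 2) ℤ → (ℝ → ℂ) → ℝ → ℂ := fun g φ t => ((|((g : Matrix (Fin 2) (Fin 2) ℤ) 1 0 : ℝ) * t + ((g : Matrix (Fin 2) (Fin 2) ℤ) 1 1 : ℝ)|⁻¹ : ℝ) : ℂ) * φ ((((g : Matrix (Fin 2) (Fin 2) ℤ) 0 0 : ℝ) * t + ((g : Matrix (Fin 2) (Fin 2) ℤ) 0 1 : ℝ)) / (((g : Matrix (Fin 2) (Fin 2) ℤ) 1 0 : ℝ) * t + ((g : Matrix (Fin 2) (Fin 2) ℤ) 1 1 : ℝ))); let IsQuarterCuspForm : ℕ → (UpperHalfPlane → ℂ) → Prop := fun N u => Literature.NumberTheory.Automorphic.IsC2 u ∧ (∀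 γ ∈ CongruenceSubgroup.Gamma1 N, ∀ z : UpperHalfPlane, u (γ • z) = u z) ∧ (∀ z : UpperHalfPlane, Literature.NumberTheory.Automorphic.hypLaplacian u z + (1 / 4 : ℂ) * u z = 0) ∧ ∃ C : ℝ, ∀ z : UpperHalfPlane, ‖u z‖ ≤ C; let lzCocycle : (UpperHalfPlane → ℂ) → Matrix.SpecialLinearGroup (Fin 2) ℤ → ℝ → ℂ := fun u γ t => ∫ τ in (0 : ℝ)..1, (let w : ℂ := (1 - (τ : ℂ)) * ((γ⁻¹ • UpperHalfPlane.I : UpperHalfPlane) : ℂ) + (τ : ℂ) * Complex.I; let dw : ℂ := Complex.I - ((γ⁻¹ • UpperHalfPlane.I : UpperHalfPlane) : ℂ); (fderiv ℝ (u ∘ UpperHalfPlane.ofComplex) w 1 - Complex.I * fderiv ℝ (u ∘ UpperHalfPlane.ofComplex) w Complex.I) / 2 * ((Real.sqrt w.im / ‖w - (t : ℂ)‖ : ℝ) : ℂ) * dw + (u ∘ UpperHalfPlane.ofComplex) w * (((fderiv ℝ (fun x : ℂ => Real.sqrt x.im / ‖x - (t : ℂ)‖) w 1 : ℝ) + Complex.I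 * (fderiv ℝ (fun x : ℂ => Real.sqrt x.im / ‖x - (t : ℂ)‖) w Complex.I : ℝ)) / 2) * (starRingEnd ℂ) dw); let IsPRQ : (ℝ → ℂ) → Prop := fun φ => ∃ F : Finset ℚ, (∀ a b : ℚ, a < b → (∀ r ∈ F, r ≤ a ∨ b ≤ r) → ∃ P Q : Polynomial ℚ, ∀ x : ℝ, (a : ℝ) < x → x < b → Polynomial.aeval (x : ℂ) Q ≠ 0 ∧ φ x = Polynomial.aeval (x : ℂ) P / Polynomial.aeval (x : ℂ) Q) ∧ ∃ B : ℚ, (∃ P Q : Polynomial ℚ, ∀ x : ℝ, (B : ℝ) < x → Polynomial.aeval (x : ℂ) Q ≠ 0 ∧ φ x = Polynomial.aeval (x : ℂ) P / Polynomial.aeval (x : ℂ) Q) ∧ (∃ P Q : Polynomial ℚ, ∀ x : ℝ, x < -(B : ℝ) → Polynomial.aeval (x : ℂ) Q ≠ 0 ∧ φ x = Polynomial.aeval (x : ℂ) P / Polynomial.aeval (x : ℂ) Q); let IsSemiAnalytic : (ℝ → ℂ) → Prop := fun f => ∃ F : Finset ℝ, AnalyticOnNhd ℝ f ((↑F : Set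 ℝ)ᶜ); let HasRationalPeriodClass : ℕ → (UpperHalfPlane → ℂ) → Prop := fun N u => ∃ (q : Matrix.SpecialLinearGroup (Fin 2) ℤ → ℝ → ℂ) (f : ℝ → ℂ), (∀ γ ∈ CongruenceSubgroup.Gamma1 N, IsPRQ (q γ)) ∧ (∀ γ ∈ CongruenceSubgroup.Gamma1 N, ∀ δ ∈ CongruenceSubgroup.Gamma1 N, ∀ᶠ t in Filter.cofinite, q (γ * δ) t = slashHalf δ (q γ) t + q δ t) ∧ IsSemiAnalytic f ∧ ∀ γ ∈ CongruenceSubgroup.Gamma1 N, ∀ᶠ t in Filter.cofinite, lzCocycle u γ t = q γ t + slashHalf γ f t - f t; ∀ N : ℕ, 0 < N → ∀ (m : ℕ) (v : Fin m → UpperHalfPlane → ℂ), (∀ j, IsQuarterCuspForm N (v j) ∧ HasRationalPeriodClass N (v j)) → LinearIndependent ℚ v → LinearIndependent ℂ v) := by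
  intro h₂ h₃ slashHalf IsQuarterCuspForm lzCocycle IsPRQ IsSemiAnalytic HasRationalPeriodClass N hN m v hv hli
  classical
  rw [Fintype.linearIndependent_iff]
  intro g hg0
  -- (0) coefficients: `g = r • e` with `e` `ℚ`-independent and `r` rational
  obtain ⟨k, e, r, he, hg⟩ := rpq_coeff_decomp g
  -- (1) period data
  have hQF : ∀ j, IsQuarterCuspForm N (v j) := fun j => (hv j).1
  have hC2v : ∀ j, Literature.NumberTheory.Automorphic.IsC2 (v j) := fun j => (hQF j).1
  have hdata : ∀ j, HasRationalPeriodClass N (v j) := fun j => (hv j).2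
  choose q f hq hcoc hfsa hper using hdata
  -- (2) the rational combinations `w l = ∑ r l j • v j`
  set w : Fin k → UpperHalfPlane → ℂ := fun l => ∑ j, ((r l j : ℚ) : ℂ) • v j with hw
  have hwQ : ∀ l, IsQuarterCuspForm N (w l) := fun l =>
    rpq_quarter_linComb N Finset.univ (fun j => ((r l j : ℚ) : ℂ)) v fun j _ => hQF j
  have hwC2 : ∀ l, Literature.NumberTheory.Automorphic.IsC2 (w l) := fun l => (hwQ l).1
  -- (3) period identity of each `w l`
  have hper_w : ∀ l, ∀ γ ∈ CongruenceSubgroup.Gamma1 N, ∀ᶠ (t : ℝ) in Filter.cofinite,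
      lzCocycle (w l) γ t = (∑ j, ((r l j : ℚ) : ℂ) * q j γ t) +
        slashHalf γ (fun s => ∑ j, ((r l j : ℚ) : ℂ) * f j s) t - ∑ j, ((r l j : ℚ) : ℂ) * f j t := by
    intro l γ hγ
    have hall : ∀ᶠ (t : ℝ) in Filter.cofinite, ∀ j,
        lzCocycle (v j) γ t = q j γ t + slashHalf γ (f j) t - f j t :=
      Filter.eventually_all.2 fun j => hper j γ hγ
    refine hall.mono fun t ht => ?_
    have h1 : lzCocycle (w l) γ t = ∑ j, ((r l j : ℚ) : ℂ) * lzCocycle (v j) γ t :=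
      rpqLZ_linComb Finset.univ (fun j => ((r l j : ℚ) : ℂ)) v (fun j _ => hC2v j) γ t
    rw [h1]
    simp only [ht]
    simp only [slashHalf]
    rw [Finset.mul_sum, ← Finset.sum_add_distrib, ← Finset.sum_sub_distrib]
    exact Finset.sum_congr rfl fun j _ => by ring
  -- (4) the relation `∑ e l • w l = ∑ g j • v j = 0`
  have hsum0 : ∑ l, e l • w l = 0 := by
    funext z
    have h0 := congrFun hg0 z
    simp only [Finset.sum_apply, Pi.smul_apply, smul_eq_mul, Pi.zero_apply] at h0
    simp only [hw, Finset.sum_apply, Pi.smul_apply, smul_eq_mul, Pi.zero_apply, Finset.mul_sum]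
    rw [Finset.sum_comm, ← h0]
    refine Finset.sum_congr rfl fun j _ => ?_
    rw [hg j, Finset.sum_mul]
    exact Finset.sum_congr rfl fun l _ => by ring
  -- (5) the summed identity: `∑ e l Q l = G - G|γ` with `G = ∑ e l F l`
  have hidG : ∀ γ ∈ CongruenceSubgroup.Gamma1 N, ∀ᶠ (t : ℝ) in Filter.cofinite,
      ∑ l, e l * (∑ j, ((r l j : ℚ) : ℂ) * q j γ t) =
        (∑ l, e l * ∑ j, ((r l j : ℚ) : ℂ) * f j t) -
          slashHalf γ (fun s => ∑ l, e l * ∑ j, ((r l j : ℚ) : ℂ) * f j s) t := by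
    intro γ hγ
    have hall : ∀ᶠ (t : ℝ) in Filter.cofinite, ∀ l,
        lzCocycle (w l) γ t = (∑ j, ((r l j : ℚ) : ℂ) * q j γ t) +
          slashHalf γ (fun s => ∑ j, ((r l j : ℚ) : ℂ) * f j s) t - ∑ j, ((r l j : ℚ) : ℂ) * f j t :=
      Filter.eventually_all.2 fun l => hper_w l γ hγ
    refine hall.mono fun t ht => ?_
    have h0 : lzCocycle (∑ l, e l • w l) γ t = 0 := by
      rw [hsum0]; exact rpqLZ_zero γ t
    have h1 : lzCocycle (∑ l, e l • w l) γ t = ∑ l, e l * lzCocycle (w l) γ t :=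
      rpqLZ_linComb Finset.univ e w (fun l _ => hwC2 l) γ t
    rw [h1] at h0
    simp only [ht] at h0
    simp only [slashHalf] at h0 ⊢
    rw [Finset.mul_sum, ← Finset.sum_sub_distrib, ← sub_eq_zero, ← Finset.sum_sub_distrib, ← h0]
    exact Finset.sum_congr rfl fun l _ => by ring
  -- (6) semi-analyticity and `PR_ℚ` data
  have hfsa' : ∀ j, ∃ F : Finset ℝ, AnalyticOnNhd ℝ (f j) ((↑F : Set ℝ)ᶜ) := fun j => hfsa j
  have hFl : ∀ l, ∃ F : Finset ℝ,
      AnalyticOnNhd ℝ (fun s => ∑ j, ((r l j : ℚ) : ℂ) * f j s) ((↑F : Set ℝ)ᶜ) := fun l =>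
    rpq_semiAnalytic_linComb Finset.univ (fun j => ((r l j : ℚ) : ℂ)) f fun j _ => hfsa' j
  have hG : ∃ F : Finset ℝ,
      AnalyticOnNhd ℝ (fun s => ∑ l, e l * ∑ j, ((r l j : ℚ) : ℂ) * f j s) ((↑F : Set ℝ)ᶜ) :=
    rpq_semiAnalytic_linComb Finset.univ e (fun l s => ∑ j, ((r l j : ℚ) : ℂ) * f j s) fun l _ => hFl l
  have hQl : ∀ l, ∀ γ ∈ CongruenceSubgroup.Gamma1 N,
      IsPRQ (fun t => ∑ j, ((r l j : ℚ) : ℂ) * q j γ t) := fun l γ hγ =>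
    rpq_isPRQ_linComb Finset.univ (r l) (fun j => q j γ) fun j _ => hq j γ hγ
  -- (7) rigidity: `G` is `PR_ℂ` up to a finite set
  obtain ⟨ρ, hρ, hGρ⟩ := h₃ N hN (fun s => ∑ l, e l * ∑ j, ((r l j : ℚ) : ℂ) * f j s) hG (fun γ hγ => by
    refine ⟨fun t => ∑ l, (-e l) * ∑ j, ((r l j : ℚ) : ℂ) * q j γ t,
      rpq_isPRC_linComb Finset.univ (fun l => -e l) (fun l t => ∑ j, ((r l j : ℚ) : ℂ) * q j γ t)
        (fun l _ => hQl l γ hγ), ?_⟩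
    refine (hidG γ hγ).mono fun t ht => ?_
    simp only [slashHalf] at ht
    beta_reduce
    simp only [neg_mul, Finset.sum_neg_distrib]
    rw [ht]
    ring)
  -- (8) the identity with `ρ` in place of `G`
  have hid2 : ∀ γ ∈ CongruenceSubgroup.Gamma1 N, ∀ᶠ (t : ℝ) in Filter.cofinite,
      ∑ l, e l * (fun l' => fun s => ∑ j, ((r l' j : ℚ) : ℂ) * q j γ s) l t = ρ t - slashHalf γ ρ t := by
    intro γ hγ
    have hdetZ : ((γ : Matrix (Fin 2) (Fin 2) ℤ) 0 0 : ℤ) * (γ : Matrix (Fin 2) (Fin 2) ℤ) 1 1 -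
        (γ : Matrix (Fin 2) (Fin 2) ℤ) 0 1 * (γ : Matrix (Fin 2) (Fin 2) ℤ) 1 0 = 1 := by
      have := Matrix.SpecialLinearGroup.det_coe γ
      rwa [Matrix.det_fin_two] at this
    have hdet : ((γ : Matrix (Fin 2) (Fin 2) ℤ) 0 0 : ℝ) * ((γ : Matrix (Fin 2) (Fin 2) ℤ) 1 1 : ℝ) -
        ((γ : Matrix (Fin 2) (Fin 2) ℤ) 0 1 : ℝ) * ((γ : Matrix (Fin 2) (Fin 2) ℤ) 1 0 : ℝ) = 1 := by
      exact_mod_cast hdetZ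
    have h4 := rpq_cofinite_moebius _ _ _ _ hdet
      (fun s => (∑ l, e l * ∑ j, ((r l j : ℚ) : ℂ) * f j s) = ρ s) (hGρ.mono fun s hs => by simpa only using hs)
    filter_upwards [hidG γ hγ, hGρ, h4] with t h1 h2 h5
    simp only [slashHalf] at h1 ⊢
    rw [h1, h2, h5]
  obtain ⟨ρc, hρc, hproj⟩ := rpq_projection e he ρ hρ
  -- (9) each `w l` has trivial period class, hence vanishes
  have hw0 : ∀ l, ∀ z, w l z = 0 := by
    intro l
    refine h₂ N hN (w l) (hwQ l) ⟨fun s => (∑ j, ((r l j : ℚ) : ℂ) * f j s) - ρc l s, ?_, fun γ hγ => ?_⟩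
    · obtain ⟨Fρ, hFρ, -⟩ := hρc l
      exact rpq_semiAnalytic_sub _ _ (hFl l) (rpq_semiAnalytic_of_isPRC (ρc l) Fρ hFρ)
    · have hq' := hproj γ (fun l' => fun s => ∑ j, ((r l' j : ℚ) : ℂ) * q j γ s)
        (fun l' => hQl l' γ hγ) (hid2 γ hγ) l
      filter_upwards [hper_w l γ hγ, hq'] with t h1 h4
      refine h1.trans ?_
      have h4' : ∑ j, ((r l j : ℚ) : ℂ) * q j γ t = ρc l t - slashHalf γ (ρc l) t := by
        simpa only using h4
      rw [h4']
      simp only [slashHalf]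
      ring
  -- (10) conclusion
  have hr0 : ∀ l j, r l j = 0 := fun l => rpq_rat_relation v hli (r l) fun z => by
    have := hw0 l z
    simpa only [hw, Finset.sum_apply, Pi.smul_apply, smul_eq_mul] using this
  intro j
  rw [hg j]
  exact Finset.sum_eq_zero fun l _ => by rw [hr0 l j, Rat.cast_zero, mul_zero]

end Summit.Langlands.Langlands.Theorems
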